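import Mathlib.Combinatorics.SimpleGraph.Paths
import Mathlib.Data.Set.Card
import Mathlib.Analysis.SpecialFunctions.Pow.Real
import HarnessLib

/-!
# Cycles of even length in graphs (Bondy–Simonovits 1974) — named fact

Topic `Literature/Combinatorics/SimpleGraph`; problem `ValiantsHypothesis`, route `GirthSidon` (D-0016):
the printed even-cycle theorem behind the route's support item
`Summit.ValiantsHypothesis.ValiantsHypothesis.Theses.GirthSidon.ShortEvenCycle` (stmt-ValiantsHypothesis-6540,
a WEAK Moore-bound form: `e ≥ 4 N^{1+1/k}` edges force SOME even cycle of length `≤ 2k`), and the source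
`[BondySimonovits1974]` of its toric/sparse engines (`ToricSwallowForcesShortRelation`,
`SparseSwallowForcesShortRelation`). Mathlib has Turán-type extremal numbers
(`SimpleGraph.extremalNumber`, `Mathlib/Combinatorics/SimpleGraph/Extremal`) but no even-cycle
(bipartite Turán) bound; the tree had none either (`lean search BondySimonovits|evenCycle` → only the route).

* `Literature.Combinatorics.SimpleGraph.BondySimonovits1974_thm1` — **Theorem 1** as printed (p. 98): "If
  `e(Gⁿ) > 100 k n^{1+1/k}`, then `C^{2l} ⊂ Gⁿ` for every integer `l ∈ [k, k n^{1/k}]`." (graphs finite,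
  simple, p. 97; `k` a positive integer.) "Contains `C^{2l}`" is rendered, exactly as the route file
  renders cycles, by a closed walk `p : G.Walk u u` with `p.IsCycle ∧ p.length = 2 l`; the number of
  edges is `G.edgeSet.ncard` (no decidability instances needed); vertices are `Fin N`.

The route item `ShortEvenCycle` is NOT an instance of this fact (its hypothesis `4^k N^{k+1} ≤ e^k`, i.e.
`e ≥ 4 N^{1+1/k}`, is weaker than `e > 100 k N^{1+1/k}`, and its conclusion — an even cycle of length
`≤ 2k` — is weaker than `C^{2k}`); it has the elementary bipartite-subgraph + minimum-degree-core + BFS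
(Moore bound) proof sketched in its docstring. Deliberately NOT here: Theorem 1* (the `E`-form with
`l ≤ E/(100 n)`, `l n^{1/l} ≤ E/(10 n)`), Theorem 2 (graphs with `c n (log n)^α` edges) and the sharpness
remarks. Nothing is asserted; users take `(h : BondySimonovits1974_thm1)`.

## References

* J. A. Bondy, M. Simonovits, *Cycles of even length in graphs*, J. Combin. Theory Ser. B 16 (1974),
  97–105, doi:10.1016/0095-8956(74)90052-5 — Theorem 1, p. 98 (READ, held
  `paper:doi-10-1016-0095-8956-74-90052-5`). [BondySimonovits1974]
-/

namespace Literature.Combinatorics.SimpleGraph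

/-- NAMED FACT (**Bondy–Simonovits 1974, Theorem 1**, p. 98: "If `e(Gⁿ) > 100 k n^{1+1/k}`, then
`C^{2l} ⊂ Gⁿ` for every integer `l ∈ [k, k n^{1/k}]`"). For every positive integer `k`, every simple
graph `G` on `N` vertices with more than `100 k N^{1+1/k}` edges contains, for every integer `l` with
`k ≤ l ≤ k N^{1/k}`, a cycle of length exactly `2l` (a closed walk `p` with `p.IsCycle` and
`p.length = 2 l`). [cite: BondySimonovits1974, Theorem 1] -/
def BondySimonovits1974_thm1 : Prop :=
  ∀ k N : ℕ, 1 ≤ k → ∀ G : _root_.SimpleGraph (Fin N),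
    (100 * k : ℝ) * (N : ℝ) ^ (1 + 1 / (k : ℝ)) < (G.edgeSet.ncard : ℝ) →
    ∀ l : ℕ, k ≤ l → (l : ℝ) ≤ k * (N : ℝ) ^ (1 / (k : ℝ)) →
      ∃ (u : Fin N) (p : G.Walk u u), p.IsCycle ∧ p.length = 2 * l

end Literature.Combinatorics.SimpleGraph
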